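import Summits.AnomalousDissipation.AnomalousDissipation.Theorems.BaireTransferRobustLoudUpgradeLinePeriodicDefs4
import Summits.AnomalousDissipation.AnomalousDissipation.Theorems.BaireTransferRobustLoudUpgradeStubPrimedTransfer
import Summits.AnomalousDissipation.AnomalousDissipation.Theorems.BaireTransferRobustLoudUpgradeStubPeriodicPersist
import Summits.AnomalousDissipation.AnomalousDissipation.Theorems.BaireTransferRobustLoudUpgradeStubLsFamilyPeriodic
import Summits.AnomalousDissipation.AnomalousDissipation.Theorems.BaireTransferRobustLoudUpgradeStubBorderedFamily

/-!
# Line `malkin-cone-group-orbits`, COMPANION skeleton c3 (lead `…-1144-c3-0`) for the crux `BaireTransfer.RobustLoudUpgrade`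
# (stmt-AnomalousDissipation-1144): Lyapunov–Schmidt crossing for TIME-PERIODIC witnesses — skeleton v4 (cycles 2–3)

Companion of the generation-1 skeleton v5 (`Lines/malkin_cone_group_orbits.lean`), of c1 (`…_c1.lean`, laminar corner) and of c2
(`…_c2.lean`, LS crossing for steady witnesses).  This file does NOT reshape those skeletons; its stubs were registered ADDITIVELY
(`workitem stub-add`).  State after cycle 2 (2026-08-16T20:0xZ) — EVERY registered stub of this companion except the residual is LANDED:

* `stub_periodicPersist` (v3 stub; Henry cashed): `PeriodicPersist.stub_periodicPersist` p119239 — `nondegPeriodic ⊆ persistPeriodic ⊆ interior LOUD`;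
* `stub_periodicCrossingPersist` (E1, periodic): `PeriodicCrossingPersist.stub_periodicCrossingPersist` p119627;
* `stub_periodicRobustCrossingClosure` (E2, periodic): `PeriodicRobustCrossingClosure.stub_periodicRobustCrossingClosure` p119657;
* `stub_borderedFamily` (v5's last non-residual stub): `BorderedFamily.stub_borderedFamily` p119744;
* `stub_primedTransfer` (planner side-deliverable): `PrimedTransfer.stub_primedTransfer` p119876 (+ `primed_of_crux`, `primed_of_tame`,
  `interior_closure_subset_of_nowhereDense`, `baireTarget_of_primed`);
* `stub_lsFamilyPeriodic` (the periodic Lyapunov–Schmidt family, hardest of cycle 1): `LsFamilyPeriodic.stub_lsFamilyPeriodic` p121537 (parts A p120030,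
  B p121233, C p121380, D/Phase p121960; Literature helpers `TimePeriodicNSLatticeLinearForced` p120011, `TimePeriodicNSLatticeLeibniz` p122383);
* `stub_lsFoldPeriodic` (TRANSVERSAL FOLDS OF CYCLES are robust crossings, hardest of cycle 2): `LsFamilyPeriodic.stub_lsFoldPeriodic` p122921
  (parts `lsFoldPeriodic_partA` p122114, `lsFoldPeriodic_partB` p122472);
* definitions + glue `…LinePeriodicDefs.lean` p120350 (`crossingPeriodic`, `robustCrossingPeriodic`, `tamePeriodic`, `line_glue_c3`,
  `crossingPeriodic_subset_robust`) and `…LinePeriodicDefs2.lean` p123123 (`foldPeriodic`, `tamePeriodic2 := tamePeriodic ∪ foldPeriodic ⊆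
  closure (interior LOUD)`, `foldPeriodic_subset_robust`, `line_glue_c3b` — registered);
* `stub_lsBorderedPeriodic` (BORDERED persistence of a simply degenerate periodic orbit with a visible force direction — the analytic half of
  the PERIODIC MALKIN CONE, cycle 3): `LsFamilyPeriodic.stub_lsBorderedPeriodic` p123446; `…LinePeriodicDefs3.lean` (`malkinPeriodic` = Malkin-visible
  simply degenerate periodic witnesses of a lattice-invariant force, `stub_malkinConePeriodic : malkinPeriodic ⊆ closure (interior LOUD)` via the landed
  abstract cone `BorderedCone.mem_closure_interior_of_bordered`, `tamePeriodic3 := tamePeriodic2 ∪ malkinPeriodic`, `line_glue_c3c` — registered);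
* `stub_lsSaddlePeriodic` (the INVISIBLE SADDLE OF CYCLES is a robust crossing — periodic twin of c2's `stub_lsIndefinite`; needs the new classical →
  lattice dictionary `Literature/Analysis/FluidPDE/TimePeriodicNSLatticeLinearToLattice.lean` p124494): parts `lsSaddlePeriodic_partA` p124547,
  `lsSaddlePeriodic_partB`, assembly `LsFamilyPeriodic.stub_lsSaddlePeriodic`; `…LinePeriodicDefs4.lean` (`saddlePeriodic`, `saddlePeriodic_subset_robust`,
  `tamePeriodic4 := tamePeriodic3 ∪ saddlePeriodic`, `line_glue_c3d` — registered).

Open: `stub_residual_c3d` (crux-sized; the v2 residual `stub_residual_c3` over `tamePeriodic` implies it, `residual_c3d_of_c3`).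
-/

set_option linter.dupNamespace false

noncomputable section

open scoped BigOperators Topology
open Filter Set Function TopologicalSpace MeasureTheory

namespace Summit.AnomalousDissipation.AnomalousDissipation.Theorems.RobustLoudUpgrade

open Literature.Analysis.FunctionSpaces Literature.Analysis.FunctionSpaces.Torus
open Literature.Analysis.FluidPDE
open Summit.AnomalousDissipation.AnomalousDissipation.Theses.BaireTransfer

namespace LsCrossingPeriodic

/-! ## §1 The landed stubs of the companion (re-exported by name, for the record) -/

/-- `stub_periodicPersist` — LANDED p119239. [folklore] -/
theorem stub_periodicPersist' : ∀ (S : Finset (Fin 3 → ℤ)) (a E ε : ℝ), nondegPeriodic S a E ε ⊆ persistPeriodic S a E ε :=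
  PeriodicPersist.stub_periodicPersist

/-- `nondegPeriodic ⊆ interior LOUD` (v2's `stub_periodicIFT`) — LANDED p119239. [folklore] -/
theorem nondegPeriodic_subset_interior_loud' (S : Finset (Fin 3 → ℤ)) (a E ε : ℝ) :
    nondegPeriodic S a E ε ⊆ interior (loud S a E ε) :=
  PeriodicPersist.nondegPeriodic_subset_interior_loud S a E ε

/-- `crossingPeriodic ⊆ interior LOUD` (E1 + periodic window) — LANDED p119627 / p120350. [folklore] -/
theorem crossingPeriodic_subset_interior_loud' (S : Finset (Fin 3 → ℤ)) (a E ε : ℝ) :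
    crossingPeriodic S a E ε ⊆ interior (loud S a E ε) :=
  crossingPeriodic_subset_interior_loud S a E ε

/-- `robustCrossingPeriodic ⊆ closure (interior LOUD)` (E2) — LANDED p119657 / p120350. [folklore] -/
theorem robustCrossingPeriodic_subset_closure_interior_loud' (S : Finset (Fin 3 → ℤ)) (a E ε : ℝ) :
    robustCrossingPeriodic S a E ε ⊆ closure (interior (loud S a E ε)) :=
  robustCrossingPeriodic_subset_closure_interior_loud S a E ε

/-- `foldPeriodic ⊆ robustCrossingPeriodic` (transversal folds of cycles) — LANDED p122921 / p123123. [folklore] -/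
theorem foldPeriodic_subset_robust' : ∀ (S : Finset (Fin 3 → ℤ)) (a E ε : ℝ), foldPeriodic S a E ε ⊆ robustCrossingPeriodic S a E ε :=
  foldPeriodic_subset_robust

/-- `malkinPeriodic ⊆ closure (interior LOUD)` (the periodic Malkin cone) — `stub_lsBorderedPeriodic` p123446 + Defs3. [folklore] -/
theorem stub_malkinConePeriodic' : ∀ (S : Finset (Fin 3 → ℤ)) (a E ε : ℝ), malkinPeriodic S a E ε ⊆ closure (interior (loud S a E ε)) :=
  stub_malkinConePeriodic

/-- `saddlePeriodic ⊆ robustCrossingPeriodic` (the invisible saddle of cycles) — `stub_lsSaddlePeriodic` + Defs4. [folklore] -/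
theorem saddlePeriodic_subset_robust' : ∀ (S : Finset (Fin 3 → ℤ)) (a E ε : ℝ), saddlePeriodic S a E ε ⊆ robustCrossingPeriodic S a E ε :=
  saddlePeriodic_subset_robust

/-- `tamePeriodic4 ⊆ closure (interior LOUD)` — Defs4. [folklore] -/
theorem tamePeriodic4_subset_closure_interior_loud' (S : Finset (Fin 3 → ℤ)) (a E ε : ℝ) :
    tamePeriodic4 S a E ε ⊆ closure (interior (loud S a E ε)) :=
  tamePeriodic4_subset_closure_interior_loud S a E ε

/-! ## §2 The one open stub: the residual (crux-sized) -/

/-- **stub_residual_c3d** (the residual of the companion after cycle 3; crux-sized, = `stub_residual_c3` with the folds of cycles, the periodic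
Malkin class and the invisible saddles of cycles moved to the tame side).  For `S ⊇ unitStock` every loud force is a limit in `P_S` of forces
carrying a TAME relaxed-loud witness of `tamePeriodic4` at budgets `(2E, ε/2)`.  Open content: loud GHOSTS (definite isola centres, steady or
periodic), multiplicity ≥ 2 (steady kernel ≥ 2 / free-period kernel ≥ 3), invisible degeneracies without saddle data, continua beyond lattice-flow
orbits; non-periodic recurrent witnesses are not witnesses at all. [folklore] -/
theorem stub_residual_c3d :
    ∀ S : Finset (Fin 3 → ℤ), unitStock ⊆ S → ∀ (a E ε : ℝ), 0 < a → 0 < ε →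
      loud S a E ε ⊆ closure (tamePeriodic4 S a (2 * E) (ε / 2)) := by
  sorry

/-- The reshapes v2 → v4 only WEAKEN the residual: the v2 residual over `tamePeriodic` implies the v4 residual. [folklore] -/
theorem residual_c3d_of_c3
    (h : ∀ S : Finset (Fin 3 → ℤ), unitStock ⊆ S → ∀ (a E ε : ℝ), 0 < a → 0 < ε →
      loud S a E ε ⊆ closure (tamePeriodic S a (2 * E) (ε / 2))) :
    ∀ S : Finset (Fin 3 → ℤ), unitStock ⊆ S → ∀ (a E ε : ℝ), 0 < a → 0 < ε →
      loud S a E ε ⊆ closure (tamePeriodic4 S a (2 * E) (ε / 2)) :=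
  fun S hS a E ε ha hε => (h S hS a E ε ha hε).trans
    (closure_mono ((Set.subset_union_left.trans Set.subset_union_left).trans Set.subset_union_left))

/-! ## §3 Composition (sorry-free): the crux BY NAME -/

/-- **Composition (companion c3): the registered stubs prove the crux `RobustLoudUpgrade` BY NAME** — `line_glue_c3d` (Defs4)
applied to the residual. [folklore] -/
theorem RobustLoudUpgrade_of : RobustLoudUpgrade :=
  line_glue_c3d stub_residual_c3d

end LsCrossingPeriodic

end Summit.AnomalousDissipation.AnomalousDissipation.Theorems.RobustLoudUpgrade

end
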